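import Literature.MathematicalPhysics.QuantumManyBody.JelliumSection5AssemblyII
import HarnessLib

/-!
# Assembly of Lieb–Solovej §5 in first quantization, III: the lower bound of the potential part

Topic `Literature/MathematicalPhysics/QuantumManyBody` (the charged Bose gas, `JelliumBoseGas.foldyLaw`).
The final combination of [LiebSolovej2001, §5] (Lemmas 5.2–5.6) for a continuous `(n+1)`-body function
`Ψ` on `Λⁿ⁺¹ = cellN` and a symmetric bounded measurable pair weight `0 ≤ w ≤ W_b` with row integrals
`≤ M`, `m(x) = ∫_Λ w(y,x)dy`, `c = ∬_{Λ²}w` (`= ℓ⁶ŵ_{00,00}`): writing the doubled potential part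
`2U = ∑_{i≠j}∫w(xᵢ,xⱼ)|Ψ|² - 2ρ∑ⱼ∫m(xⱼ)|Ψ|² + ρ²c‖Ψ‖²`, the main part kept is the `ŵ_{00,00}`
structure `ℓ⁻⁶c∑_{i≠j}‖PᵢPⱼΨ‖² - 2ρℓ⁻³c∑ⱼ‖PⱼΨ‖² + ρ²c‖Ψ‖²` (`= ŵ_{00,00}⟨(n̂₀-ρℓ³)² - n̂₀⟩` by
`JelliumLemma52` / `JelliumCondensateAlgebra`) plus the Bogoliubov pairing blocks
`2∑_{i≠j}∫wRe(conj(PᵢPⱼΨ)QᵢQⱼΨ)` (`ŵ_{pq,00}a*a*a₀a₀ + h.c.`), and everything else is an error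
controlled by `⟨n̂₊⟩`, `⟨n̂₊²⟩`, `∑ⱼ‖Aⱼ‖²` (`Aⱼ = (ℓ⁻³N̂ⱼ - ρ)PⱼΨ`), `∑_{i≠j}‖PᵢQⱼΨ‖²`:

* `double_sum_split` — algebra of the per-pair sums;
* `section5_lowerBound` — **the first-quantized form of the conclusion of §5** (used at the start of
  §6: "`H^n_{ℓ,r,R} ≥ ½γ⁻¹∑-Δ + H_Q - errors`", potential part).

## References

* [LiebSolovej2001] E. H. Lieb, J. P. Solovej, Commun. Math. Phys. 217 (2001) 127–163, §5 (Lemmas 5.2–5.6)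
  and the first display of §6 (arXiv:cond-mat/0007425, pp. 11–14).
-/

noncomputable section

open MeasureTheory Set Filter Real
open scoped ENNReal NNReal Topology ComplexConjugate

namespace Literature.MathematicalPhysics.QuantumManyBody.JelliumBoseGas

open BoseGas

variable {n : ℕ} {ℓ : ℝ}

/-- Splitting a double sum of the per-pair combination. [folklore] -/
theorem double_sum_split {N : ℕ} (F1 F2 F3 G1 G2 G3 E : Fin N → Fin N → ℝ) :
    ∑ i : Fin N, ∑ j ∈ Finset.univ.erase i,
        (F1 i j + F2 i j + F3 i j + 2 * (G1 i j + G2 i j + G3 i j) - E i j) =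
      (∑ i : Fin N, ∑ j ∈ Finset.univ.erase i, F1 i j) +
        (∑ i : Fin N, ∑ j ∈ Finset.univ.erase i, (F2 i j + F3 i j)) +
        2 * (∑ i : Fin N, ∑ j ∈ Finset.univ.erase i, (G1 i j + G2 i j)) +
        2 * (∑ i : Fin N, ∑ j ∈ Finset.univ.erase i, G3 i j) -
        ∑ i : Fin N, ∑ j ∈ Finset.univ.erase i, E i j := by
  simp only [Finset.sum_add_distrib, Finset.sum_sub_distrib, Finset.mul_sum, mul_add]
  ring

/-- **[LiebSolovej2001, §5, conclusion] The potential part of `H^n_{ℓ,r,R}` is bounded below by its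
condensate-plus-pairing part up to controlled errors (first quantization).** For `ℓ > 0`, a symmetric
bounded measurable pair weight `0 ≤ w ≤ W_b` whose row integrals are `≤ M < ∞` (as `ℝ≥0∞` integrals of
`ofReal w`), `m(x) = ∫_Λ w(y,x)dy`, `c = ∫_Λ∫_Λ w`, a continuous `(n+1)`-body function `Ψ`, `ρ, S ∈ ℝ`,
`0 < ε ≤ ½`, `ε₁ > 0`:
`ℓ⁻⁶c∑_{i≠j}‖PᵢPⱼΨ‖² - 2ρℓ⁻³c∑ⱼ‖PⱼΨ‖² + ρ²cS + 2∑_{i≠j}∫wRe(conj(PᵢPⱼΨ)QᵢQⱼΨ)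
  - 2([ρ-(n+1)ℓ⁻³]₊M⟨n̂₊⟩ + ℓ⁻³M⟨n̂₊²⟩) - 2∑ⱼ(ε₁ℓ⁻³c‖Aⱼ‖² + ε₁⁻¹∫m(xⱼ)|QⱼΨ|²)
  - (1+ε⁻¹)ℓ⁻³M∑_{i≠j}(‖PᵢQⱼΨ‖² + ‖QᵢPⱼΨ‖²)
  ≤ ∑_{i≠j}∫w(xᵢ,xⱼ)|Ψ|² - 2ρ∑ⱼ∫m(xⱼ)|Ψ|² + ρ²cS`
(all sums over ordered pairs; norms in `L²(Λⁿ⁺¹)` as `toReal`s). [cite: LiebSolovej2001, §5] -/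
theorem section5_lowerBound (hℓ : 0 < ℓ) {w : Space → Space → ℝ} (hw : Measurable (Function.uncurry w))
    (hw0 : ∀ x y, 0 ≤ w x y) {Wb : ℝ} (hWb : ∀ x y, |w x y| ≤ Wb) (hsymm : ∀ x y, w x y = w y x)
    {M : ℝ≥0∞} (hM : M ≠ ⊤) (hrow : ∀ x, ∫⁻ y in cell ℓ, ENNReal.ofReal (w x y) ≤ M)
    {Ψ : Config (n + 1) → ℂ} (hΨ : Continuous Ψ) (ρ S : ℝ) {ε : ℝ} (hε : 0 < ε) (hε2 : ε ≤ 1 / 2)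
    {ε₁ : ℝ} (hε₁ : 0 < ε₁) :
    (ℓ ^ 3)⁻¹ * (ℓ ^ 3)⁻¹ * (∫ x in cell ℓ, ∫ y in cell ℓ, w x y) *
          (∑ i : Fin (n + 1), ∑ j ∈ Finset.univ.erase i,
            (∫⁻ X in cellN (n + 1) ℓ, (‖sliceMean ℓ i (sliceMean ℓ j Ψ) X‖₊ : ℝ≥0∞) ^ 2).toReal) -
        2 * ρ * ((ℓ ^ 3)⁻¹ * (∫ x in cell ℓ, ∫ y in cell ℓ, w x y) *
          ∑ j : Fin (n + 1), (∫⁻ X in cellN (n + 1) ℓ, (‖sliceMean ℓ j Ψ X‖₊ : ℝ≥0∞) ^ 2).toReal) +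
        ρ ^ 2 * (∫ x in cell ℓ, ∫ y in cell ℓ, w x y) * S +
        2 * (∑ i : Fin (n + 1), ∑ j ∈ Finset.univ.erase i, ∫ X in cellN (n + 1) ℓ, w (X i) (X j) *
          (conj (sliceMean ℓ i (sliceMean ℓ j Ψ) X) * sliceFluct ℓ i (sliceFluct ℓ j Ψ) X).re) -
        2 * (max (ρ - (n + 1 : ℕ) / ℓ ^ 3) 0 * M.toReal *
            (∑ i : Fin (n + 1), ∫⁻ X in cellN (n + 1) ℓ, (‖sliceFluct ℓ i Ψ X‖₊ : ℝ≥0∞) ^ 2).toReal +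
          (ℓ ^ 3)⁻¹ * M.toReal *
            ((∑ i : Fin (n + 1), ∫⁻ X in cellN (n + 1) ℓ, (‖sliceFluct ℓ i Ψ X‖₊ : ℝ≥0∞) ^ 2) +
              ∑ i : Fin (n + 1), ∑ j ∈ Finset.univ.erase i,
                ∫⁻ X in cellN (n + 1) ℓ, (‖sliceFluct ℓ j (sliceFluct ℓ i Ψ) X‖₊ : ℝ≥0∞) ^ 2).toReal) -
        2 * (∑ j : Fin (n + 1), (ε₁ * ((ℓ ^ 3)⁻¹ * (∫ x in cell ℓ, ∫ y in cell ℓ, w x y) *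
            (∫⁻ X in cellN (n + 1) ℓ, (‖(((ℓ ^ 3)⁻¹ : ℝ) : ℂ) *
              (∑ i ∈ Finset.univ.erase j, sliceMean ℓ i (sliceMean ℓ j Ψ) X) -
                (ρ : ℂ) * sliceMean ℓ j Ψ X‖₊ : ℝ≥0∞) ^ 2).toReal) +
          ε₁⁻¹ * (∫⁻ X in cellN (n + 1) ℓ, ENNReal.ofReal (∫ y in cell ℓ, w y (X j)) *
            (‖sliceFluct ℓ j Ψ X‖₊ : ℝ≥0∞) ^ 2).toReal)) -
        (1 + ε⁻¹) * ((ℓ ^ 3)⁻¹ * M.toReal) *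
          (∑ i : Fin (n + 1), ∑ j ∈ Finset.univ.erase i,
            ((∫⁻ X in cellN (n + 1) ℓ, (‖sliceMean ℓ i (sliceFluct ℓ j Ψ) X‖₊ : ℝ≥0∞) ^ 2).toReal +
              (∫⁻ X in cellN (n + 1) ℓ, (‖sliceFluct ℓ i (sliceMean ℓ j Ψ) X‖₊ : ℝ≥0∞) ^ 2).toReal)) ≤
      (∑ i : Fin (n + 1), ∑ j ∈ Finset.univ.erase i, ∫ X in cellN (n + 1) ℓ, w (X i) (X j) * ‖Ψ X‖ ^ 2) -
        2 * ρ * (∑ j : Fin (n + 1), ∫ X in cellN (n + 1) ℓ, (∫ y in cell ℓ, w y (X j)) * ‖Ψ X‖ ^ 2) +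
        ρ ^ 2 * (∫ x in cell ℓ, ∫ y in cell ℓ, w x y) * S := by
  obtain ⟨hmm, hm0, hmb⟩ := column_weight_props hℓ.le hw hw0 hWb
  -- (A) the summed pair bound
  have hA := sum_pair_lowerBound hℓ hw hw0 hWb hsymm hM hrow hΨ hε hε2
  simp only [condensatePieces_zero, condensatePieces_one, condensatePieces_two,
    condensatePieces_three] at hA
  have hsplit := double_sum_split (N := n + 1)
    (fun i j => ∫ X in cellN (n + 1) ℓ, w (X i) (X j) * ‖sliceMean ℓ i (sliceMean ℓ j Ψ) X‖ ^ 2)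
    (fun i j => ∫ X in cellN (n + 1) ℓ, w (X i) (X j) * ‖sliceMean ℓ i (sliceFluct ℓ j Ψ) X‖ ^ 2)
    (fun i j => ∫ X in cellN (n + 1) ℓ, w (X i) (X j) * ‖sliceFluct ℓ i (sliceMean ℓ j Ψ) X‖ ^ 2)
    (fun i j => ∫ X in cellN (n + 1) ℓ, w (X i) (X j) *
      (conj (sliceMean ℓ i (sliceMean ℓ j Ψ) X) * sliceMean ℓ i (sliceFluct ℓ j Ψ) X).re)
    (fun i j => ∫ X in cellN (n + 1) ℓ, w (X i) (X j) *
      (conj (sliceMean ℓ i (sliceMean ℓ j Ψ) X) * sliceFluct ℓ i (sliceMean ℓ j Ψ) X).re)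
    (fun i j => ∫ X in cellN (n + 1) ℓ, w (X i) (X j) *
      (conj (sliceMean ℓ i (sliceMean ℓ j Ψ) X) * sliceFluct ℓ i (sliceFluct ℓ j Ψ) X).re)
    (fun i j => (1 + ε⁻¹) * ((ℓ ^ 3)⁻¹ * M.toReal) *
      ((∫⁻ X in cellN (n + 1) ℓ, (‖sliceMean ℓ i (sliceFluct ℓ j Ψ) X‖₊ : ℝ≥0∞) ^ 2).toReal +
        (∫⁻ X in cellN (n + 1) ℓ, (‖sliceFluct ℓ i (sliceMean ℓ j Ψ) X‖₊ : ℝ≥0∞) ^ 2).toReal))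
  have hEsplit : ∑ i : Fin (n + 1), ∑ j ∈ Finset.univ.erase i, (1 + ε⁻¹) * ((ℓ ^ 3)⁻¹ * M.toReal) *
      ((∫⁻ X in cellN (n + 1) ℓ, (‖sliceMean ℓ i (sliceFluct ℓ j Ψ) X‖₊ : ℝ≥0∞) ^ 2).toReal +
        (∫⁻ X in cellN (n + 1) ℓ, (‖sliceFluct ℓ i (sliceMean ℓ j Ψ) X‖₊ : ℝ≥0∞) ^ 2).toReal) =
      (1 + ε⁻¹) * ((ℓ ^ 3)⁻¹ * M.toReal) * ∑ i : Fin (n + 1), ∑ j ∈ Finset.univ.erase i,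
        ((∫⁻ X in cellN (n + 1) ℓ, (‖sliceMean ℓ i (sliceFluct ℓ j Ψ) X‖₊ : ℝ≥0∞) ^ 2).toReal +
          (∫⁻ X in cellN (n + 1) ℓ, (‖sliceFluct ℓ i (sliceMean ℓ j Ψ) X‖₊ : ℝ≥0∞) ^ 2).toReal) := by
    rw [Finset.mul_sum]
    refine Finset.sum_congr rfl fun i _ => ?_
    rw [Finset.mul_sum]
  -- the background expansion summed over the particles
  have hBG : ∑ j : Fin (n + 1), ∫ X in cellN (n + 1) ℓ, (∫ y in cell ℓ, w y (X j)) * ‖Ψ X‖ ^ 2 =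
      (∑ j : Fin (n + 1), ∫ X in cellN (n + 1) ℓ, (∫ y in cell ℓ, w y (X j)) * ‖sliceMean ℓ j Ψ X‖ ^ 2) +
        (∑ j : Fin (n + 1), ∫ X in cellN (n + 1) ℓ, (∫ y in cell ℓ, w y (X j)) * ‖sliceFluct ℓ j Ψ X‖ ^ 2) +
        2 * ∑ j : Fin (n + 1), ∫ X in cellN (n + 1) ℓ, (∫ y in cell ℓ, w y (X j)) *
          (conj (sliceMean ℓ j Ψ X) * sliceFluct ℓ j Ψ X).re := by
    rw [Finset.sum_congr rfl fun j _ => background_expansion (ℓ := ℓ) hmm hmb j hΨ,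
      Finset.sum_add_distrib, Finset.sum_add_distrib, ← Finset.mul_sum]
  -- the one-`Q` regrouping and the Lemma 5.5 group
  have hR := sum_R01_add_R02 hℓ hsymm hΨ (Ψ := Ψ)
  have hC := oneQ_group_lowerBound hℓ hw hw0 hWb hΨ ρ hε₁
  rw [integral_colWeight_eq hsymm] at hC
  have hCsplit : 4 * ∑ j : Fin (n + 1), ((∑ i ∈ Finset.univ.erase j, ∫ X in cellN (n + 1) ℓ, w (X i) (X j) *
        (conj (sliceMean ℓ i (sliceMean ℓ j Ψ) X) * sliceMean ℓ i (sliceFluct ℓ j Ψ) X).re) -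
      ρ * ∫ X in cellN (n + 1) ℓ, (∫ y in cell ℓ, w y (X j)) * (conj (sliceMean ℓ j Ψ X) * sliceFluct ℓ j Ψ X).re) =
      4 * (∑ j : Fin (n + 1), ∑ i ∈ Finset.univ.erase j, ∫ X in cellN (n + 1) ℓ, w (X i) (X j) *
        (conj (sliceMean ℓ i (sliceMean ℓ j Ψ) X) * sliceMean ℓ i (sliceFluct ℓ j Ψ) X).re) -
      4 * ρ * ∑ j : Fin (n + 1), ∫ X in cellN (n + 1) ℓ, (∫ y in cell ℓ, w y (X j)) *
        (conj (sliceMean ℓ j Ψ X) * sliceFluct ℓ j Ψ X).re := by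
    rw [Finset.sum_sub_distrib, ← Finset.mul_sum]
    ring
  -- the Lemma 5.3 group and the `ŵ₀₀` identifications
  have hB := lemma53_group_lowerBound hℓ hw hw0 hWb hsymm hM hrow hΨ ρ
  have hD0 := sum_D0_eq_toReal hℓ hw hw0 hWb hΨ (Ψ := Ψ)
  have hDP := sum_bgPP_eq hℓ hw hw0 hWb hsymm hΨ (Ψ := Ψ)
  -- assemble
  have step1 := hsplit.symm.trans_le hA
  rw [hEsplit] at step1
  have step2 : 2 * (∑ i : Fin (n + 1), ∑ j ∈ Finset.univ.erase i,
      ((∫ X in cellN (n + 1) ℓ, w (X i) (X j) *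
          (conj (sliceMean ℓ i (sliceMean ℓ j Ψ) X) * sliceMean ℓ i (sliceFluct ℓ j Ψ) X).re) +
        ∫ X in cellN (n + 1) ℓ, w (X i) (X j) *
          (conj (sliceMean ℓ i (sliceMean ℓ j Ψ) X) * sliceFluct ℓ i (sliceMean ℓ j Ψ) X).re)) -
      4 * ρ * ∑ j : Fin (n + 1), ∫ X in cellN (n + 1) ℓ, (∫ y in cell ℓ, w y (X j)) *
        (conj (sliceMean ℓ j Ψ X) * sliceFluct ℓ j Ψ X).re ≥
      -(2 * ∑ j : Fin (n + 1), (ε₁ * ((ℓ ^ 3)⁻¹ * (∫ x in cell ℓ, ∫ y in cell ℓ, w x y) *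
            (∫⁻ X in cellN (n + 1) ℓ, (‖(((ℓ ^ 3)⁻¹ : ℝ) : ℂ) *
              (∑ i ∈ Finset.univ.erase j, sliceMean ℓ i (sliceMean ℓ j Ψ) X) -
                (ρ : ℂ) * sliceMean ℓ j Ψ X‖₊ : ℝ≥0∞) ^ 2).toReal) +
          ε₁⁻¹ * (∫⁻ X in cellN (n + 1) ℓ, ENNReal.ofReal (∫ y in cell ℓ, w y (X j)) *
            (‖sliceFluct ℓ j Ψ X‖₊ : ℝ≥0∞) ^ 2).toReal)) := by
    rw [hR]
    linarith [hC, hCsplit]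
  -- multiply the background identities by `ρ` (products are atoms for `linarith`)
  have hBGρ : 2 * ρ * (∑ j : Fin (n + 1), ∫ X in cellN (n + 1) ℓ, (∫ y in cell ℓ, w y (X j)) * ‖Ψ X‖ ^ 2) =
      2 * ρ * (∑ j : Fin (n + 1), ∫ X in cellN (n + 1) ℓ, (∫ y in cell ℓ, w y (X j)) * ‖sliceMean ℓ j Ψ X‖ ^ 2) +
        2 * ρ * (∑ j : Fin (n + 1), ∫ X in cellN (n + 1) ℓ, (∫ y in cell ℓ, w y (X j)) * ‖sliceFluct ℓ j Ψ X‖ ^ 2) +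
        4 * ρ * ∑ j : Fin (n + 1), ∫ X in cellN (n + 1) ℓ, (∫ y in cell ℓ, w y (X j)) *
          (conj (sliceMean ℓ j Ψ X) * sliceFluct ℓ j Ψ X).re := by
    rw [hBG]; ring
  have hDPρ : 2 * ρ * (∑ j : Fin (n + 1), ∫ X in cellN (n + 1) ℓ, (∫ y in cell ℓ, w y (X j)) *
      ‖sliceMean ℓ j Ψ X‖ ^ 2) = 2 * ρ * ((ℓ ^ 3)⁻¹ * (∫ x in cell ℓ, ∫ y in cell ℓ, w x y) *
        ∑ j : Fin (n + 1), (∫⁻ X in cellN (n + 1) ℓ, (‖sliceMean ℓ j Ψ X‖₊ : ℝ≥0∞) ^ 2).toReal) := by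
    rw [hDP]
  linarith [step1, step2, hBGρ, hB, hD0, hDPρ]

end Literature.MathematicalPhysics.QuantumManyBody.JelliumBoseGas
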